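import Literature.Computability.MetaComplexity.RobustHegedusLemma
import HarnessLib

/-!
# Hegedűs's lemma (exact form): low-degree polynomials cannot separate Hamming layers `k` and `k + p^ℓ`

**Hegedűs's lemma** (Hegedűs 2010; Srinivasan 2023, Lemma 1.1; Srinivasan–Venkitesh 2021,
Thm 1.5 for the general closure statement): let `F` be a field of characteristic `p > 0`, `q = p^ℓ`,
and `P ∈ F[x₁,…,xₙ]` a polynomial that vanishes at every point of the Hamming layer `{0,1}ⁿ_k` but
not at some point of the layer `{0,1}ⁿ_{k+q}`, where `k ≥ q`; then `deg P ≥ q`. Equivalently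
(`eval_eq_zero_of_forall_wt_eq`): a polynomial function of degree `< q` (an element of the tree's
`Smolensky.lowDeg F n d`, `d < q`) vanishing on layer `k` vanishes on layer `k + q`. We prove it for
`k + 1 ≥ q` (slightly more than the printed `k ≥ q`), in particular in the `𝔽₂`-shape
`hegedus_exact_F2` requested by the QuantumAdvantage cell qa-qnc0 (planner file `Sketch4.lean`,
`HegedusExactF2`: `d < 2^j`, `2^j ≤ k`, `k + 2^j ≤ n`).

PROOF (elementary; ours — the printed proofs use Gröbner bases [Hegedűs] resp. the Combinatorial
Nullstellensatz [Srinivasan, Alon]; cf. Srinivasan 2023 §1 "an elementary proof of this was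
recently given by the author and independently by Alon"). (1) RESTRICTION: permute coordinates so
that the non-vanishing point `b` is `1^{k+q}0^{n-k-q}`, keep `N = 2q − 1` of its one-coordinates
free, fix the other `k + 1 − q` ones and all zeros (`Hegedus.extendPt`,
`comp_extendPt_perm_mem_lowDeg`), and complement the free coordinates (`Smolensky.bnot`,
`funLeft_bnot_mem_lowDeg`): this yields `f ∈ lowDeg F N d` vanishing on the layer `{0,1}^N_q` with
`f(0^N) = P(b)`. (2) THE IDENTITY (`sum_apply_indPt_eq`): for EVERY `f ∈ lowDeg F (2q−1) d`,
`d < q`: `Σ_{|S| = q} f(1_S) = C(2q−1, q) · f(0)` — on a monomial `x_T`, `|T| = t ≤ d`, the left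
side counts the `q`-sets containing `T`, `C(2q−1−t, q−t) = C(q−1+a, a)` with `a = q − t ∈ [1, q−1]`,
which is `≡ 0 (mod p)` for `t ≥ 1` (`choose_prime_pow_pred_add_modEq_zero`, a two-case induction on
`ℓ` with the one-step Lucas congruence — Kummer's carry), while for `T = ∅` both sides are
`C(2q−1, q)`. (3) `C(2q−1, q) ≡ ⌊(2q−1)/q⌋ = 1 (mod p)` (Lucas, the tree's
`Hegedus.cast_choose_prime_pow`), so vanishing on layer `q` forces `f(0) = 0`, i.e. `P(b) = 0`.

## References
* G. Hegedűs, *Balancing sets of vectors*, Studia Sci. Math. Hungar. 47 (2010) 333–349, Thm 1.?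
  (the lemma; `k = n/2`-type parameters) [Hegedus2010].
* S. Srinivasan, *A robust version of Hegedűs's lemma, with applications*, TheoretiCS 2 (2023)
  art. 5, Lemma 1.1 (statement in the generality `k ∈ [q, n − q]`) [Srinivasan2023].
-/

noncomputable section

namespace Literature.Computability.MetaComplexity

open Finset Smolensky

namespace Hegedus

variable {F : Type*} [Field F]

/-! ### Indicator points and monomials -/

/-- `wt 1_S = |S|` for the indicator point `1_S = (i ↦ [i ∈ S])`. [folklore] -/
private theorem wt_indPt {N : ℕ} (S : Finset (Fin N)) :
    wt (fun i : Fin N => decide (i ∈ S)) = S.card := by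
  unfold wt
  congr 1
  ext i
  simp

/-- `wt 1^N = N`. [folklore] -/
private theorem wt_true (N : ℕ) : wt (fun _ : Fin N => true) = N := by
  simp [wt]

/-- `wt b ≤ n`. [folklore] -/
private theorem wt_le {n : ℕ} (b : Fin n → Bool) : wt b ≤ n := by
  unfold wt
  exact (Finset.card_filter_le _ _).trans (by simp)

/-- `x_T(1_S) = [T ⊆ S]`. [folklore] -/
private theorem mono_indPt {N : ℕ} (T S : Finset (Fin N)) :
    mono F T (fun i => decide (i ∈ S)) = if T ⊆ S then 1 else 0 := by
  rw [mono_apply]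
  by_cases h : T ⊆ S
  · rw [if_pos h, if_pos (fun i hi => by simpa using h hi)]
  · rw [if_neg h, if_neg (fun h' => h fun i hi => by simpa using h' i hi)]

/-- `x_T(0^N) = [T = ∅]`. [folklore] -/
private theorem mono_apply_false {N : ℕ} (T : Finset (Fin N)) :
    mono F T (fun _ => false) = if T = ∅ then 1 else 0 := by
  rw [mono_apply]
  by_cases h : T = ∅
  · subst h; simp
  · obtain ⟨i, hi⟩ := Finset.nonempty_iff_ne_empty.mpr h
    rw [if_neg h, if_neg (fun h' => Bool.false_ne_true (h' i hi))]

/-- The number of `q`-subsets of `[N]` containing a fixed `T` is `C(N − |T|, q − |T|)`. [folklore] -/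
private theorem card_filter_superset {N : ℕ} (T : Finset (Fin N)) {q : ℕ} (hT : T.card ≤ q) :
    ((powersetCard q (univ : Finset (Fin N))).filter fun S => T ⊆ S).card =
      (N - T.card).choose (q - T.card) := by
  classical
  have hdisj : ∀ R : Finset (Fin N), R ⊆ Tᶜ → Disjoint R T := fun R hR =>
    Finset.disjoint_left.mpr fun x hx hxT => (Finset.mem_compl.mp (hR hx)) hxT
  have hc : Tᶜ.card = N - T.card := by rw [Finset.card_compl, Fintype.card_fin]
  rw [← hc, ← Finset.card_powersetCard]
  refine Finset.card_bij' (fun S _ => S \ T) (fun R _ => R ∪ T) (fun S hS => ?_) (fun R hR => ?_)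
    (fun S hS => ?_) (fun R hR => ?_)
  · rw [Finset.mem_filter, Finset.mem_powersetCard] at hS
    rw [Finset.mem_powersetCard]
    refine ⟨fun x hx => Finset.mem_compl.mpr (Finset.mem_sdiff.mp hx).2, ?_⟩
    rw [Finset.card_sdiff_of_subset hS.2, hS.1.2]
  · rw [Finset.mem_powersetCard] at hR
    rw [Finset.mem_filter, Finset.mem_powersetCard]
    refine ⟨⟨Finset.subset_univ _, ?_⟩, Finset.subset_union_right⟩
    rw [Finset.card_union_of_disjoint (hdisj R hR.1), hR.2]
    omega
  · rw [Finset.mem_filter] at hS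
    exact Finset.sdiff_union_of_subset hS.2
  · rw [Finset.mem_powersetCard] at hR
    rw [Finset.union_sdiff_right, Finset.sdiff_eq_self_iff_disjoint]
    exact hdisj R hR.1

/-! ### The two binomial congruences -/

/-- **Kummer's carry, the case we need:** `p ∣ C(p^ℓ − 1 + a, a)` for `1 ≤ a < p^ℓ` (adding `a` to
`p^ℓ − 1` in base `p` produces a carry). Proof: induction on `ℓ` with the one-step Lucas congruence
`C(n, k) ≡ C(n mod p, k mod p)·C(⌊n/p⌋, ⌊k/p⌋)`. [folklore] -/
private theorem choose_prime_pow_pred_add_modEq_zero (p : ℕ) [hp : Fact p.Prime] :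
    ∀ (ℓ a : ℕ), 1 ≤ a → a < p ^ ℓ → (p ^ ℓ - 1 + a).choose a ≡ 0 [MOD p] := by
  intro ℓ
  induction ℓ with
  | zero => intro a h1 h2; simp at h2; omega
  | succ ℓ ih =>
    intro a h1 h2
    have hp1 : 1 ≤ p := hp.out.one_lt.le
    have hq1 : 1 ≤ p ^ ℓ := Nat.one_le_pow _ _ hp.out.pos
    have hq1' : 1 ≤ p ^ (ℓ + 1) := Nat.one_le_pow _ _ hp.out.pos
    have hdm : p * (a / p) + a % p = a := Nat.div_add_mod a p
    have hmod : a % p < p := Nat.mod_lt _ hp.out.pos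
    have hpow : p ^ (ℓ + 1) = p * p ^ ℓ := pow_succ' p ℓ
    refine (Choose.choose_modEq_choose_mod_mul_choose_div_nat (n := p ^ (ℓ + 1) - 1 + a)
      (k := a) (p := p)).trans ?_
    by_cases h0 : a % p = 0
    · -- no carry in the last digit: recurse on the higher digits
      have ha' : 1 ≤ a / p := Nat.one_le_iff_ne_zero.mpr fun h => by
        rw [h, h0, mul_zero] at hdm; omega
      have ha'' : a / p < p ^ ℓ := by
        by_contra h
        have h3 : p * (a / p) ≤ a := by omega
        have h4 : p * p ^ ℓ ≤ p * (a / p) := Nat.mul_le_mul_left _ (not_lt.mp h)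
        rw [hpow] at h2
        omega
      have hdm0 : p * (a / p) = a := by rw [h0, add_zero] at hdm; exact hdm
      have hn : p ^ (ℓ + 1) - 1 + a = p * (p ^ ℓ - 1 + a / p) + (p - 1) := by
        zify [hp1, hq1, hq1'] at hdm0 hpow ⊢
        linear_combination hpow - hdm0
      have hmod1 : (p ^ (ℓ + 1) - 1 + a) % p = p - 1 := by
        rw [hn, Nat.mul_add_mod]; exact Nat.mod_eq_of_lt (by omega)
      have hdiv1 : (p ^ (ℓ + 1) - 1 + a) / p = p ^ ℓ - 1 + a / p := by
        rw [hn, Nat.mul_add_div hp.out.pos, Nat.div_eq_of_lt (by omega : p - 1 < p), add_zero]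
      rw [hmod1, hdiv1, h0, Nat.choose_zero_right, one_mul]
      exact ih (a / p) ha' ha''
    · -- a carry in the last digit: the last-digit binomial vanishes
      have hn : p ^ (ℓ + 1) - 1 + a = p * (p ^ ℓ + a / p) + (a % p - 1) := by
        have h0' : 1 ≤ a % p := Nat.one_le_iff_ne_zero.mpr h0
        zify [hp1, hq1, hq1', h0'] at hdm hpow ⊢
        linear_combination hpow - hdm
      have hmod1 : (p ^ (ℓ + 1) - 1 + a) % p = a % p - 1 := by
        rw [hn, Nat.mul_add_mod]; exact Nat.mod_eq_of_lt (by omega)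
      rw [hmod1, Nat.choose_eq_zero_of_lt (by omega), zero_mul]

/-- `C(2q − 1, q) ≡ 1 (mod p)` for `q = p^ℓ` (Lucas: the quotient `⌊(2q−1)/q⌋ = 1`), as an identity
in a field of characteristic `p`. [folklore] -/
private theorem cast_choose_two_mul_prime_pow_pred (p : ℕ) [hp : Fact p.Prime] [CharP F p] (ℓ : ℕ) :
    (((2 * p ^ ℓ - 1).choose (p ^ ℓ) : ℕ) : F) = 1 := by
  have hq1 : 1 ≤ p ^ ℓ := Nat.one_le_pow _ _ hp.out.pos
  rw [cast_choose_prime_pow p ℓ (2 * p ^ ℓ - 1)]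
  have hdiv : (2 * p ^ ℓ - 1) / p ^ ℓ = 1 :=
    Nat.div_eq_of_lt_le (by omega) (by omega)
  rw [hdiv, Nat.mod_eq_of_lt hp.out.one_lt, Nat.cast_one]

/-! ### The identity on `lowDeg_{< q}` over the cube of dimension `2q − 1` -/

/-- **The identity.** For `q = p^ℓ`, `N = 2q − 1` and every `f ∈ lowDeg F N d` with `d < q`:
`Σ_{|S| = q} f(1_S) = C(2q − 1, q) · f(0^N)` — on a monomial `x_T` the left side is the number
`C(N − |T|, q − |T|)` of `q`-sets containing `T`, divisible by `p` unless `T = ∅`. [folklore] -/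
private theorem sum_apply_indPt_eq (p : ℕ) [hp : Fact p.Prime] [CharP F p] (ℓ : ℕ) {N d : ℕ}
    (hN : N = 2 * p ^ ℓ - 1) (hd : d < p ^ ℓ) {f : CubeFn F N} (hf : f ∈ lowDeg F N d) :
    ∑ S ∈ powersetCard (p ^ ℓ) (univ : Finset (Fin N)), f (fun i => decide (i ∈ S)) =
      (((N.choose (p ^ ℓ)) : ℕ) : F) * f (fun _ => false) := by
  classical
  have hq1 : 1 ≤ p ^ ℓ := Nat.one_le_pow _ _ hp.out.pos
  rw [lowDeg_eq_span] at hf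
  induction hf using Submodule.span_induction with
  | mem g hg =>
    obtain ⟨⟨T, hT⟩, rfl⟩ := hg
    simp only [mono_indPt, mono_apply_false]
    rw [Finset.sum_boole, card_filter_superset T (hT.trans hd.le)]
    by_cases hT0 : T = ∅
    · subst hT0
      simp
    · have h1 : 1 ≤ T.card := Finset.one_le_card.mpr (Finset.nonempty_iff_ne_empty.mpr hT0)
      have hNT : N - T.card = p ^ ℓ - 1 + (p ^ ℓ - T.card) := by omega
      rw [if_neg hT0, mul_zero, hNT]
      exact (CharP.cast_eq_zero_iff F p _).mpr (Nat.modEq_zero_iff_dvd.mp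
        (choose_prime_pow_pred_add_modEq_zero p ℓ (p ^ ℓ - T.card) (by omega) (by omega)))
  | zero => simp
  | add g h _ _ ihg ihh =>
    simp only [Pi.add_apply, Finset.sum_add_distrib, ihg, ihh, mul_add]
  | smul c g _ ih =>
    simp only [Pi.smul_apply, smul_eq_mul, ← Finset.mul_sum, ih]
    ring

/-- **Core step.** With `q = p^ℓ`, `N = 2q − 1`, `d < q`: a degree-`≤ d` function on `{0,1}^N` that
vanishes on the whole layer `{0,1}^N_q` vanishes at `0^N`. [folklore] -/
private theorem apply_false_eq_zero_of_forall_wt_eq (p : ℕ) [hp : Fact p.Prime] [CharP F p] (ℓ : ℕ)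
    {N d : ℕ} (hN : N = 2 * p ^ ℓ - 1) (hd : d < p ^ ℓ) {f : CubeFn F N} (hf : f ∈ lowDeg F N d)
    (hvan : ∀ a : Fin N → Bool, wt a = p ^ ℓ → f a = 0) : f (fun _ => false) = 0 := by
  have hsum := sum_apply_indPt_eq p ℓ hN hd hf
  have hzero : ∑ S ∈ powersetCard (p ^ ℓ) (univ : Finset (Fin N)), f (fun i => decide (i ∈ S)) = 0 :=
    Finset.sum_eq_zero fun S hS => hvan _ (by rw [wt_indPt]; exact (Finset.mem_powersetCard.mp hS).2)
  have hC : (((N.choose (p ^ ℓ)) : ℕ) : F) = 1 := by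
    rw [hN]; exact cast_choose_two_mul_prime_pow_pred p ℓ
  rw [hzero, hC, one_mul] at hsum
  exact hsum.symm

/-! ### Hegedűs's lemma -/

/-- **Hegedűs's lemma, exact form** (vanishing version). Let `F` have characteristic `p`, `q = p^ℓ`,
`q ≤ k + 1`, and let `P : {0,1}ⁿ → F` have degree `≤ d < q` (`P ∈ lowDeg F n d`). If `P` vanishes at
every point of Hamming weight `k`, then `P` vanishes at every point of Hamming weight `k + q`.
(Printed with `k ∈ [q, n − q]` and the contrapositive conclusion `deg P ≥ q`.)
[cite: Srinivasan2023, Lemma 1.1] -/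
theorem eval_eq_zero_of_forall_wt_eq (p : ℕ) [hp : Fact p.Prime] [CharP F p] {n ℓ k d : ℕ}
    (hk : p ^ ℓ ≤ k + 1) (hd : d < p ^ ℓ) {P : CubeFn F n} (hP : P ∈ lowDeg F n d)
    (hvan : ∀ a : Fin n → Bool, wt a = k → P a = 0) {b : Fin n → Bool} (hb : wt b = k + p ^ ℓ) :
    P b = 0 := by
  have hq1 : 1 ≤ p ^ ℓ := Nat.one_le_pow _ _ hp.out.pos
  have hbn : k + p ^ ℓ ≤ n := hb ▸ wt_le b
  -- the free block has `N = 2q - 1` coordinates, followed by `r₁ = k + 1 - q` fixed ones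
  set N : ℕ := 2 * p ^ ℓ - 1 with hN
  set r₁ : ℕ := k + 1 - p ^ ℓ with hr₁
  have hNr : N + r₁ = k + p ^ ℓ := by omega
  have hle : N + r₁ ≤ n := by omega
  -- sort `b`: `b = s ∘ σ` with `s = 1^{k+q} 0^{n-k-q} = extendPt n N r₁ 1^N`
  have hws : wt (extendPt n N r₁ fun _ : Fin N => true) = wt b := by
    rw [wt_extendPt hle, wt_true, hNr, hb]
  obtain ⟨σ, hσ⟩ := exists_perm_of_wt_eq hws.symm
  -- restrict and complement
  set Q : CubeFn F N := fun a => P (extendPt n N r₁ a ∘ σ) with hQ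
  have hQmem : Q ∈ lowDeg F N d := comp_extendPt_perm_mem_lowDeg N r₁ σ hP
  have hfmem : LinearMap.funLeft F F bnot Q ∈ lowDeg F N d := funLeft_bnot_mem_lowDeg hQmem
  have hfvan : ∀ a : Fin N → Bool, wt a = p ^ ℓ → LinearMap.funLeft F F bnot Q a = 0 := by
    intro a ha
    rw [LinearMap.funLeft_apply]
    refine hvan _ ?_
    rw [wt_comp_perm, wt_extendPt hle, show bnot a = fun i => !a i from rfl, wt_not, ha]
    omega
  have h0 := apply_false_eq_zero_of_forall_wt_eq p ℓ hN hd hfmem hfvan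
  rw [LinearMap.funLeft_apply] at h0
  have hb' : bnot (fun _ : Fin N => false) = fun _ => true := funext fun _ => rfl
  rw [hQ] at h0
  simp only [hb'] at h0
  rwa [← hσ] at h0

/-- **Hegedűs's lemma, exact form** (degree version, as printed): in characteristic `p`, with
`q = p^ℓ ≤ k + 1`, a polynomial function of degree `≤ d` that vanishes on the layer `{0,1}ⁿ_k` but
not at some point of weight `k + q` has `d ≥ q`. [cite: Srinivasan2023, Lemma 1.1] -/
theorem prime_pow_le_of_apply_ne_zero (p : ℕ) [Fact p.Prime] [CharP F p] {n ℓ k d : ℕ}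
    (hk : p ^ ℓ ≤ k + 1) {P : CubeFn F n} (hP : P ∈ lowDeg F n d)
    (hvan : ∀ a : Fin n → Bool, wt a = k → P a = 0) {b : Fin n → Bool} (hb : wt b = k + p ^ ℓ)
    (hPb : P b ≠ 0) : p ^ ℓ ≤ d := by
  by_contra h
  exact hPb (eval_eq_zero_of_forall_wt_eq p hk (not_le.mp h) hP hvan hb)

/-- **Hegedűs's lemma over `𝔽₂`** in the shape used by the QuantumAdvantage cell qa-qnc0
(`HegedusExactF2`): degree `< 2^j`, vanishing on the layer `k` with `2^j ≤ k`, `k + 2^j ≤ n` ⟹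
vanishing on the layer `k + 2^j`. [cite: Srinivasan2023, Lemma 1.1] -/
theorem hegedus_exact_F2 :
    ∀ n j k d : ℕ, d < 2 ^ j → 2 ^ j ≤ k → k + 2 ^ j ≤ n →
      ∀ P : CubeFn (ZMod 2) n, P ∈ lowDeg (ZMod 2) n d →
        (∀ u : Fin n → Bool, wt u = k → P u = 0) → ∀ u : Fin n → Bool, wt u = k + 2 ^ j → P u = 0 :=
  fun _ j _ _ hd hk _ _ hP hvan _ hu =>
    eval_eq_zero_of_forall_wt_eq (F := ZMod 2) 2 (ℓ := j) (by omega) hd hP hvan hu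

end Hegedus

end Literature.Computability.MetaComplexity
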